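import Summits.CriticalPhenomena.Ising3DConformalLimit.Theses.HarmonicMomentsIsotropy
import Literature.Probability.LatticeModels.SharpLengthDCP

/-!
# Birth skeleton (BC3) for crux `CorrelationLengthWindow` — route HarmonicMomentsIsotropy, item stmt-CriticalPhenomena-6032

The crux (ξ₂-window of the near-critical two-point function of n.n. Ising on `ℤ³`) is the plain
conjunction (i) INNER CRITICALITY ∧ (ii) ONE LENGTH (route two-layer plan:
`CorrelationLengthWindow ⇐ InnerCriticality → OneLength`).  This skeleton keeps (i) as one stub
and routes (ii) through the Duminil-Copin–Panis SHARP LENGTH `L(β)`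
(`Literature.Probability.LatticeModels.sharpLength`, arXiv:2404.05700 Def. 1.1), following the
refuter's recorded mutation on the item ("replacing ξ₂ by the sharp length in (ii) makes it close
to provable-now; then L(β) ≍ ξ₂ is needed separately"):

* `stub_innerCriticality`      — clause (i) verbatim: `G_β ≥ (1-ε) G_{β_c}` inside `√s·ξ₂(β)`   [open, hyperscaling-type]
* `stub_sharpLengthWindow`     — ONE LENGTH in DC–Panis units: eventually `L(β) ≤ √A₀ · ξ₂(β)`,
                                  i.e. `∃ ℓ ≥ L(β)` with `ℓ² χ(β) ≤ A₀ M₂(β)`                     [open in d = 3; d ≥ 4: DC–Panis Thm 1.6 gives L = ξ^{1+o(1)}]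
* `stub_liebSimonTailTransfer` — Lieb–Simon iteration at the sharp length: a witness `S ∋ 0`,
                                  `diam S ≤ 2ℓ`, `φ_β(S) < 1/2` gives `Σ_{‖x‖∞ > j(2ℓ+1)} G_β ≤ 2^{-j} χ(β)`
                                  (DCT 2016 Lemma 2.7 = tree `isingTwoPoint_free_le_modifiedSimon`,
                                  `tanh β ≤ β`), and `|x|₂² ≤ 3‖x‖∞²` converts `|x|₂ > A ξ₂ ≥ A ℓ/√A₀`
                                  into `j = ⌊A/(3√(3A₀))⌋` steps: clause (ii) with `c = log 2/(3√(3A₀))`, `C = 2` [provable now, size M/L]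
* `CorrelationLengthWindow_of` — the assembly, pure logic: `⟨(i), transfer (window)⟩` (hypotheses keyed by the
                                  registered stub names via `Registered.stub_*` aliases); `CorrelationLengthWindow_proof` closes the
                                  crux modulo exactly the three stubs.

`G = twoPointFree 3`, `χ β = Σ' G β`, `M₂ β = Σ' |x|₂² G β`, `ξ₂² = M₂/χ`, exactly as in the crux.
-/

namespace Summit.CriticalPhenomena.Ising3DConformalLimit.Cruxes.CorrelationLengthWindow.Birth

open Literature.Probability.LatticeModels

/-! ## §1 The stub statements (named `Prop`s; `G, r2, χ, M₂` as in the crux) -/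

/-- **INNER CRITICALITY = clause (i) of the crux, verbatim.** For every `ε > 0` there are `s > 0` and
`β₀ < β_c` such that `G_β(x) ≥ (1-ε)·⟨σ₀σ_x⟩_{β_c}` whenever `|x|₂²·χ(β) ≤ s·M₂(β)` (i.e.
`|x|₂ ≤ √s·ξ₂(β)`) and `β₀ ≤ β < β_c`.  Open in `d = 3` (continuity of the near-critical scaling
function at the origin with constant `1-ε`; DC–Panis-type plateau bounds give `c·G_{β_c}` only).
Sources: DuminilcopinPanis2025 (arXiv:2404.05700) §1.1, Thm 1.3; CampostriniEtAl1998. -/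
def InnerCriticality : Prop :=
  let G : ℝ → Site 3 → ℝ := twoPointFree 3; let r2 : Site 3 → ℝ := (fun x : Site 3 => ∑ i, ((x i : ℝ)) ^ 2); let χ : ℝ → ℝ := fun β => ∑' x : Site 3, G β x; let M₂ : ℝ → ℝ := fun β => ∑' x : Site 3, r2 x * G β x; (∀ ε : ℝ, 0 < ε → ∃ s : ℝ, 0 < s ∧ ∃ β₀ : ℝ, β₀ < criticalBeta 3 ∧ ∀ β : ℝ, β₀ ≤ β → β < criticalBeta 3 → ∀ x : Site 3, r2 x * χ β ≤ s * M₂ β → (1 - ε) * criticalTwoPoint 3 x ≤ G β x)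

/-- **SHARP LENGTH INSIDE THE ξ₂-WINDOW (one length, DC–Panis units).** There are `A₀` and
`β₀ < β_c` such that for every `β ∈ [β₀, β_c)` the sharp length is finite and bounded by the
second-moment correlation length: some `ℓ : ℕ` has `L(β) ≤ ℓ` and `ℓ²·χ(β) ≤ A₀·M₂(β)`
(`ℓ ≤ √A₀·ξ₂(β)`).  Open in `d = 3` (DC–Panis Thm 1.6 proves `L(β) = ξ(β)^{1+o(1)}` for `d ≥ 4`
only; p. 6: "the relation between these quantities is not clear a priori").  Why it might fail:
two parametrically different near-critical lengths `L(β) ≫ ξ₂(β)` (logarithmic or power gap across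
the η-window `c|x|⁻² ≤ G ≤ C|x|⁻¹`).  Sources: arXiv:2404.05700 Def. 1.1, Thm 1.6;
DuminilCopinTassionCMP2016. -/
def SharpLengthWindow : Prop :=
  let G : ℝ → Site 3 → ℝ := twoPointFree 3; let r2 : Site 3 → ℝ := (fun x : Site 3 => ∑ i, ((x i : ℝ)) ^ 2); let χ : ℝ → ℝ := fun β => ∑' x : Site 3, G β x; let M₂ : ℝ → ℝ := fun β => ∑' x : Site 3, r2 x * G β x; (∃ A₀ : ℝ, ∃ β₀ : ℝ, β₀ < criticalBeta 3 ∧ ∀ β : ℝ, β₀ ≤ β → β < criticalBeta 3 → ∃ ℓ : ℕ, sharpLength 3 β ≤ (ℓ : ℕ∞) ∧ ((ℓ : ℝ)) ^ 2 * χ β ≤ A₀ * M₂ β)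

/-- **ONE LENGTH = clause (ii) of the crux, verbatim**: relative exponential tails of `G_β` at scale
`ξ₂(β)`, uniformly for `β ∈ [β₀, β_c)`. (Conclusion of the transfer below; not itself a stub.) -/
def OneLength : Prop :=
  let G : ℝ → Site 3 → ℝ := twoPointFree 3; let r2 : Site 3 → ℝ := (fun x : Site 3 => ∑ i, ((x i : ℝ)) ^ 2); let χ : ℝ → ℝ := fun β => ∑' x : Site 3, G β x; let M₂ : ℝ → ℝ := fun β => ∑' x : Site 3, r2 x * G β x; (∃ c C : ℝ, 0 < c ∧ ∃ β₀ : ℝ, β₀ < criticalBeta 3 ∧ ∀ β : ℝ, β₀ ≤ β → β < criticalBeta 3 → ∀ A : ℝ, 1 ≤ A → (∑' x : Site 3, (if A ^ 2 * M₂ β < r2 x * χ β then G β x else 0)) ≤ C * Real.exp (-(c * A)) * χ β)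

/-- **LIEB–SIMON TAIL TRANSFER (provable now): `SharpLengthWindow → OneLength`.** Mechanism: a
witness `S ∋ 0`, `diam S ≤ 2ℓ`, `φ_β(S) < 1/2` of `L(β) ≤ ℓ` (the infimum in `ℕ∞` is attained) and
the modified Simon inequality (DCT 2016 Lemma 2.7, tree: `isingTwoPoint_free_le_modifiedSimon`,
passed to infinite volume with `hasBoxLimit_isingCorr_free`; `tanh β ≤ β`) give
`T((j+1)(2ℓ+1)) ≤ φ_β(S)·T(j(2ℓ+1))` for `T(r) = Σ_{‖x‖∞ > r} G_β(x)`, hence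
`T(j(2ℓ+1)) ≤ 2^{-j}·χ(β)`; with `|x|₂² ≤ 3‖x‖∞²`, `χ ≥ G_β(0) = 1 > 0` and `ℓ² χ ≤ A₀ M₂`, the
region `A²M₂ < |x|₂²χ` lies in `‖x‖∞ > j(2ℓ+1)` for `j = ⌊A/(3√(3A₀))⌋`, so (ii) holds with
`c = log 2/(3√(3A₀))`, `C = 2`.  Sources: Simon1980, Lieb1980, DuminilCopinTassionCMP2016 Lemma 2.7,
arXiv:2404.05700 eq. (1.4). -/
def LiebSimonTailTransfer : Prop :=
  SharpLengthWindow → OneLength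

/-! ## §2 Registered stubs -/

/-- stub 1 (open, hardest): inner criticality with constant `1-ε` at scale `√s·ξ₂`. -/
theorem stub_innerCriticality : InnerCriticality := by
  sorry

/-- stub 2 (open, the one-length input proper): `L(β) ≤ √A₀·ξ₂(β)` eventually. -/
theorem stub_sharpLengthWindow : SharpLengthWindow := by
  sorry

/-- stub 3 (provable now, size M/L): Lieb–Simon iteration at the sharp length, transported to `ξ₂`. -/
theorem stub_liebSimonTailTransfer : LiebSimonTailTransfer := by
  sorry

/-! ### Name-keyed aliases of the stub statements (hypotheses of the composition) -/
namespace Registered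

/-- Alias of `InnerCriticality` keyed by the registered stub name. -/
abbrev stub_innerCriticality : Prop := InnerCriticality
/-- Alias of `SharpLengthWindow` keyed by the registered stub name. -/
abbrev stub_sharpLengthWindow : Prop := SharpLengthWindow
/-- Alias of `LiebSimonTailTransfer` keyed by the registered stub name. -/
abbrev stub_liebSimonTailTransfer : Prop := LiebSimonTailTransfer

end Registered

/-! ## §3 Composition — the crux BY NAME -/

/-- **Assembly.** `InnerCriticality → SharpLengthWindow → LiebSimonTailTransfer → CorrelationLengthWindow`:
clause (i) is stub 1, clause (ii) is the Lieb–Simon transfer applied to the sharp-length window.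
Pure logic; concludes the route decl by name. -/
theorem CorrelationLengthWindow_of (h₁ : Registered.stub_innerCriticality)
    (h₂ : Registered.stub_sharpLengthWindow) (h₃ : Registered.stub_liebSimonTailTransfer) :
    Summit.CriticalPhenomena.Ising3DConformalLimit.Theses.HarmonicMomentsIsotropy.CorrelationLengthWindow :=
  And.intro h₁ (h₃ h₂)

/-- The crux from the registered stubs (closed modulo exactly `stub_innerCriticality`,
`stub_sharpLengthWindow`, `stub_liebSimonTailTransfer`). -/
theorem CorrelationLengthWindow_proof :
    Summit.CriticalPhenomena.Ising3DConformalLimit.Theses.HarmonicMomentsIsotropy.CorrelationLengthWindow :=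
  CorrelationLengthWindow_of stub_innerCriticality stub_sharpLengthWindow stub_liebSimonTailTransfer

end Summit.CriticalPhenomena.Ising3DConformalLimit.Cruxes.CorrelationLengthWindow.Birth
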